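import Mathlib
import HarnessLib

/-!
# Projection-based guaranteed lower eigenvalue bound (Liu), counting form

Topic `Literature/Analysis/OperatorTheory`; proofs-layer file. This is the abstract mechanism behind the
guaranteed lower eigenvalue bounds of X. Liu, *A framework of verified eigenvalue bounds for self-adjoint
differential operators*, Appl. Math. Comput. 267 (2015) 341–355, Thm 2.1, restated as Thm 2.2 of
X. Liu, arXiv:2607.04247 (2026) (assumptions (A1)–(A3)): for the pencil of two symmetric positive
semidefinite forms `a, b`, exact eigenpairs `b(u_i,u_j) = δ_ij`, `a(u_i,u_j) = λ_j δ_ij`, a finite-dimensional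
trial space with a projection `proj` that is `a`-orthogonal (`a(Πφ, φ − Πφ) = 0`) and has the error constant
`b(φ − Πφ, φ − Πφ) ≤ C² a(φ − Πφ, φ − Πφ)`, one gets `λ_k ≥ λ_{k,N} / (1 + C² λ_{k,N})`.

We prove the COUNTING form a validated computation actually uses (`liu_count_bound`): if the discrete form
is coercive, `s·b(v,v) ≤ a(v,v)`, on the part of the range of `proj` cut out by `m` linear conditions
(`m` = number of discrete eigenvalues below `s`, or the number of negative eigenvalues of the certified
inertia of `K − sM`; the conditions are arbitrary linear functionals, so Euclidean as well as `b`-orthogonality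
is covered), then ANY `b`-orthonormal, `a`-diagonal family of `k > m` vectors with `a`-values `≤ Λ` forces
`s ≤ Λ (1 + C² s)`, i.e. `Λ ≥ s/(1 + C² s)`. Contrapositive: at most `m` exact eigenvalues lie below
`s/(1 + C² s)`. The proof is Liu's (Pythagoras for `a`, triangle inequality for `b`, the two constants), with the
two cases `proj` injective / not injective on `E_k` merged into one dimension count. Pure linear algebra over `ℝ`;
no topology. [cite: Liu2015, Thm 2.1] [cite: Liu2026, Thm 2.2]
-/

namespace Literature.Analysis.OperatorTheory

open scoped BigOperators
open Finset

variable {V : Type*} [AddCommGroup V] [Module ℝ V]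

/-- Expansion of a bilinear form on a finite linear combination against a Kronecker family. [folklore] -/
theorem bilin_sum_sum_of_kronecker (b : LinearMap.BilinForm ℝ V) {k : ℕ} (u : Fin k → V) (d : Fin k → ℝ)
    (hb : ∀ i j, b (u i) (u j) = if i = j then d i else 0) (c : Fin k → ℝ) :
    b (∑ i, c i • u i) (∑ j, c j • u j) = ∑ i, d i * c i ^ 2 := by
  simp only [map_sum, map_smul, LinearMap.sum_apply, LinearMap.smul_apply, smul_eq_mul, hb]
  refine Finset.sum_congr rfl fun i _ => ?_
  rw [Finset.mul_sum]
  simp only [mul_ite, mul_zero, Finset.sum_ite_eq', Finset.mem_univ, if_true]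
  ring

/-- Expansion `b(tP − Q, tP − Q) = t² b(P,P) − 2t b(P,Q) + b(Q,Q)` for a symmetric bilinear form. [folklore] -/
theorem bilin_smul_sub_self (b : LinearMap.BilinForm ℝ V) (hsymm : ∀ x y, b x y = b y x) (t : ℝ) (P Q : V) :
    b (t • P - Q) (t • P - Q) = t ^ 2 * b P P - 2 * t * b P Q + b Q Q := by
  simp only [map_sub, map_smul, LinearMap.sub_apply, LinearMap.smul_apply, smul_eq_mul]
  rw [hsymm Q P]
  ring

/-- Expansion `f(P + Q, P + Q) = f(P,P) + 2 f(P,Q) + f(Q,Q)` for a symmetric bilinear form. [folklore] -/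
theorem bilin_add_self (f : LinearMap.BilinForm ℝ V) (hsymm : ∀ x y, f x y = f y x) (P Q : V) :
    f (P + Q) (P + Q) = f P P + 2 * f P Q + f Q Q := by
  simp only [map_add, LinearMap.add_apply]
  rw [hsymm Q P]
  ring

/-- **Liu's projection-based lower bound, one-vector core.** For symmetric positive semidefinite `a, b`,
a vector `φ` with `a(Πφ, φ − Πφ) = 0`, the approximation constant `b(φ−Πφ, φ−Πφ) ≤ C² a(φ−Πφ, φ−Πφ)` and
discrete coercivity `s b(Πφ,Πφ) ≤ a(Πφ,Πφ)` at `Πφ`, one has `s b(φ,φ) ≤ (1 + C² s) a(φ,φ)`.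
[cite: Liu2015, Thm 2.1] [cite: Liu2026, Thm 2.2] -/
theorem liu_one_vector (a b : LinearMap.BilinForm ℝ V)
    (ha_symm : ∀ x y, a x y = a y x) (hb_symm : ∀ x y, b x y = b y x)
    (ha_nonneg : ∀ x, 0 ≤ a x x) (hb_nonneg : ∀ x, 0 ≤ b x x)
    {C s : ℝ} (hC : 0 < C) (hs : 0 < s) (proj : V →ₗ[ℝ] V) (φ : V)
    (horth : a (proj φ) (φ - proj φ) = 0)
    (happrox : b (φ - proj φ) (φ - proj φ) ≤ C ^ 2 * a (φ - proj φ) (φ - proj φ))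
    (hcoer : s * b (proj φ) (proj φ) ≤ a (proj φ) (proj φ)) :
    s * b φ φ ≤ (1 + C ^ 2 * s) * a φ φ := by
  set P := proj φ with hP
  set Q := φ - proj φ with hQ
  have hφ : φ = P + Q := by rw [hP, hQ]; abel
  have haPP := ha_nonneg P
  have haQQ := ha_nonneg Q
  have hbPP := hb_nonneg P
  have hbQQ := hb_nonneg Q
  -- Pythagoras for `a`
  have ha_split : a φ φ = a P P + a Q Q := by
    rw [hφ, bilin_add_self a ha_symm P Q, horth]; ring
  -- expansion for `b`
  have hb_split : b φ φ = b P P + 2 * b P Q + b Q Q := by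
    rw [hφ, bilin_add_self b hb_symm P Q]
  -- Young / Cauchy–Schwarz for the psd form `b` with parameter `t = C² s`
  set t := C ^ 2 * s with ht
  have htpos : 0 < t := by rw [ht]; positivity
  have hyoung : 2 * t * b P Q ≤ t ^ 2 * b P P + b Q Q := by
    have h := hb_nonneg (t • P - Q)
    rw [bilin_smul_sub_self b hb_symm t P Q] at h
    linarith
  -- assemble: multiply the goal by t > 0
  have key : t * (s * b φ φ) ≤ t * ((1 + C ^ 2 * s) * a φ φ) := by
    rw [hb_split, ha_split]
    have h1 : t * s * (2 * b P Q) ≤ s * (t ^ 2 * b P P + b Q Q) := by nlinarith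
    have h2 : s * b Q Q ≤ s * (C ^ 2 * a Q Q) := mul_le_mul_of_nonneg_left happrox hs.le
    have h3 : s * C ^ 2 = t := by rw [ht]; ring
    nlinarith [mul_nonneg htpos.le haPP, mul_nonneg htpos.le haQQ, mul_nonneg htpos.le hbPP,
      mul_nonneg hs.le hbQQ, hcoer, sq_nonneg C]
  exact le_of_mul_le_mul_left key htpos

/-- **Liu's guaranteed lower eigenvalue bound, counting form.** Let `a, b` be symmetric positive semidefinite
bilinear forms on a real vector space, `u : Fin k → V` a `b`-orthonormal and `a`-diagonal family with `a`-values
`lam i ≤ Λ` ((A1)), `proj` a linear map with `a(Πφ, φ − Πφ) = 0` and `b(φ−Πφ,φ−Πφ) ≤ C² a(φ−Πφ,φ−Πφ)` on the span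
of the family ((A3)), and suppose the discrete problem is coercive with constant `s` on the part of `Π(span u)`
annihilated by `m < k` linear functionals `ℓ j` (e.g. `b`-orthogonality to the first `m` discrete eigenvectors,
`s = λ_{m+1,N}`; or Euclidean orthogonality to the negative eigenvectors of a certified inertia of `K − sM`).
Then `s ≤ Λ (1 + C² s)`, i.e. `λ_k ≥ s / (1 + C² s)`: at most `m` members of any exact eigenfamily lie below
`s/(1 + C² s)`. No a priori information on the exact spectrum is used. [cite: Liu2015, Thm 2.1] [cite: Liu2026, Thm 2.2] -/
theorem liu_count_bound (a b : LinearMap.BilinForm ℝ V)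
    (ha_symm : ∀ x y, a x y = a y x) (hb_symm : ∀ x y, b x y = b y x)
    (ha_nonneg : ∀ x, 0 ≤ a x x) (hb_nonneg : ∀ x, 0 ≤ b x x)
    {k m : ℕ} (hmk : m < k) (u : Fin k → V) (lam : Fin k → ℝ) {Λ C s : ℝ}
    (hb_on : ∀ i j, b (u i) (u j) = if i = j then 1 else 0)
    (ha_on : ∀ i j, a (u i) (u j) = if i = j then lam i else 0)
    (hlam : ∀ i, lam i ≤ Λ) (hC : 0 < C) (hs : 0 < s)
    (proj : V →ₗ[ℝ] V) (ℓ : Fin m → V →ₗ[ℝ] ℝ)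
    (horth : ∀ φ ∈ Submodule.span ℝ (Set.range u), a (proj φ) (φ - proj φ) = 0)
    (happrox : ∀ φ ∈ Submodule.span ℝ (Set.range u),
      b (φ - proj φ) (φ - proj φ) ≤ C ^ 2 * a (φ - proj φ) (φ - proj φ))
    (hcoer : ∀ φ ∈ Submodule.span ℝ (Set.range u), (∀ j, ℓ j (proj φ) = 0) →
      s * b (proj φ) (proj φ) ≤ a (proj φ) (proj φ)) :
    s ≤ Λ * (1 + C ^ 2 * s) := by
  classical
  -- the linear map c ↦ (ℓ j (Π (∑ c i • u i)))_j has a nontrivial kernel since k > m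
  let vec : (Fin k → ℝ) →ₗ[ℝ] V := Fintype.linearCombination ℝ u
  let T : (Fin k → ℝ) →ₗ[ℝ] (Fin m → ℝ) := LinearMap.pi fun j => (ℓ j) ∘ₗ proj ∘ₗ vec
  have hlt : Module.finrank ℝ (Fin m → ℝ) < Module.finrank ℝ (Fin k → ℝ) := by
    simpa [Module.finrank_fin_fun] using hmk
  obtain ⟨c, hcker, hc0⟩ :=
    Submodule.exists_mem_ne_zero_of_ne_bot (LinearMap.ker_ne_bot_of_finrank_lt hlt (f := T))
  set φ : V := ∑ i, c i • u i with hφdef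
  have hvec : vec c = φ := by
    simp [vec, Fintype.linearCombination_apply, hφdef]
  have hφmem : φ ∈ Submodule.span ℝ (Set.range u) := by
    refine Submodule.sum_mem _ fun i _ => Submodule.smul_mem _ _ (Submodule.subset_span ⟨i, rfl⟩)
  have hℓ : ∀ j, ℓ j (proj φ) = 0 := by
    intro j
    have h := congr_fun (LinearMap.mem_ker.mp hcker) j
    simpa [T, LinearMap.pi_apply, hvec] using h
  -- b(φ,φ) = ∑ c_i², a(φ,φ) = ∑ λ_i c_i²
  have hbφ : b φ φ = ∑ i, c i ^ 2 := by
    rw [hφdef, bilin_sum_sum_of_kronecker b u (fun _ => (1 : ℝ)) (by simpa using hb_on) c]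
    simp
  have haφ : a φ φ = ∑ i, lam i * c i ^ 2 := by
    rw [hφdef, bilin_sum_sum_of_kronecker a u lam ha_on c]
  -- b(φ,φ) > 0
  have hbpos : 0 < b φ φ := by
    rw [hbφ]
    obtain ⟨i, hi⟩ : ∃ i, c i ≠ 0 := by
      simpa using Function.ne_iff.mp hc0
    have hle : c i ^ 2 ≤ ∑ j, c j ^ 2 :=
      Finset.single_le_sum (f := fun j => c j ^ 2) (fun j _ => sq_nonneg (c j)) (Finset.mem_univ i)
    have : 0 < c i ^ 2 := by positivity
    linarith
  -- a(φ,φ) ≤ Λ b(φ,φ)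
  have haΛ : a φ φ ≤ Λ * b φ φ := by
    rw [haφ, hbφ, Finset.mul_sum]
    exact Finset.sum_le_sum fun i _ => mul_le_mul_of_nonneg_right (hlam i) (sq_nonneg _)
  -- one-vector core
  have hcore := liu_one_vector a b ha_symm hb_symm ha_nonneg hb_nonneg hC hs proj φ
    (horth φ hφmem) (happrox φ hφmem) (hcoer φ hφmem hℓ)
  have h1C : 0 ≤ 1 + C ^ 2 * s := by positivity
  have : s * b φ φ ≤ (Λ * (1 + C ^ 2 * s)) * b φ φ := by
    calc s * b φ φ ≤ (1 + C ^ 2 * s) * a φ φ := hcore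
      _ ≤ (1 + C ^ 2 * s) * (Λ * b φ φ) := mul_le_mul_of_nonneg_left haΛ h1C
      _ = (Λ * (1 + C ^ 2 * s)) * b φ φ := by ring
  exact le_of_mul_le_mul_right this hbpos

/-- The bound in Liu's printed form: `s / (1 + C² s) ≤ Λ`. [cite: Liu2015, Thm 2.1] [cite: Liu2026, Thm 2.2] -/
theorem liu_count_bound_div {Λ C s : ℝ} (hC : 0 < C) (hs : 0 < s) (h : s ≤ Λ * (1 + C ^ 2 * s)) :
    s / (1 + C ^ 2 * s) ≤ Λ := by
  have hden : 0 < 1 + C ^ 2 * s := by positivity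
  rw [div_le_iff₀ hden]
  exact h

/-- **Liu's bound with comparison forms (monotone minorant / frozen coefficients).** As `liu_count_bound`, but the
projection, the approximation constant and the discrete coercivity are those of a COMPARISON pair `(a', b')` with
`a' ≤ a` and `b ≤ b'` as quadratic forms (e.g. `a'` = the form with an elementwise Loewner minorant of the potential
and frozen elementwise minimal weights, `b'` = the mass with frozen maximal weights), while `u` is an exact
eigenfamily of the ORIGINAL pair `(a, b)`. Conclusion unchanged: `s ≤ Λ (1 + C² s)`. This replaces the minimax /
potential-monotonicity step of the printed argument by a direct Rayleigh-quotient comparison on `span u`.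
[cite: Liu2015, Thm 2.1] [cite: Liu2026, Thm 2.2] -/
theorem liu_count_bound_of_le (a b a' b' : LinearMap.BilinForm ℝ V)
    (ha'_symm : ∀ x y, a' x y = a' y x) (hb'_symm : ∀ x y, b' x y = b' y x)
    (ha'_nonneg : ∀ x, 0 ≤ a' x x) (hb'_nonneg : ∀ x, 0 ≤ b' x x)
    (ha'_le : ∀ x, a' x x ≤ a x x) (hb_le : ∀ x, b x x ≤ b' x x)
    {k m : ℕ} (hmk : m < k) (u : Fin k → V) (lam : Fin k → ℝ) {Λ C s : ℝ}
    (hb_on : ∀ i j, b (u i) (u j) = if i = j then 1 else 0)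
    (ha_on : ∀ i j, a (u i) (u j) = if i = j then lam i else 0)
    (hlam : ∀ i, lam i ≤ Λ) (hC : 0 < C) (hs : 0 < s)
    (proj : V →ₗ[ℝ] V) (ℓ : Fin m → V →ₗ[ℝ] ℝ)
    (horth : ∀ φ ∈ Submodule.span ℝ (Set.range u), a' (proj φ) (φ - proj φ) = 0)
    (happrox : ∀ φ ∈ Submodule.span ℝ (Set.range u),
      b' (φ - proj φ) (φ - proj φ) ≤ C ^ 2 * a' (φ - proj φ) (φ - proj φ))
    (hcoer : ∀ φ ∈ Submodule.span ℝ (Set.range u), (∀ j, ℓ j (proj φ) = 0) →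
      s * b' (proj φ) (proj φ) ≤ a' (proj φ) (proj φ)) :
    s ≤ Λ * (1 + C ^ 2 * s) := by
  classical
  let vec : (Fin k → ℝ) →ₗ[ℝ] V := Fintype.linearCombination ℝ u
  let T : (Fin k → ℝ) →ₗ[ℝ] (Fin m → ℝ) := LinearMap.pi fun j => (ℓ j) ∘ₗ proj ∘ₗ vec
  have hlt : Module.finrank ℝ (Fin m → ℝ) < Module.finrank ℝ (Fin k → ℝ) := by
    simpa [Module.finrank_fin_fun] using hmk
  obtain ⟨c, hcker, hc0⟩ :=
    Submodule.exists_mem_ne_zero_of_ne_bot (LinearMap.ker_ne_bot_of_finrank_lt hlt (f := T))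
  set φ : V := ∑ i, c i • u i with hφdef
  have hvec : vec c = φ := by
    simp [vec, Fintype.linearCombination_apply, hφdef]
  have hφmem : φ ∈ Submodule.span ℝ (Set.range u) := by
    refine Submodule.sum_mem _ fun i _ => Submodule.smul_mem _ _ (Submodule.subset_span ⟨i, rfl⟩)
  have hℓ : ∀ j, ℓ j (proj φ) = 0 := by
    intro j
    have h := congr_fun (LinearMap.mem_ker.mp hcker) j
    simpa [T, LinearMap.pi_apply, hvec] using h
  have hbφ : b φ φ = ∑ i, c i ^ 2 := by
    rw [hφdef, bilin_sum_sum_of_kronecker b u (fun _ => (1 : ℝ)) (by simpa using hb_on) c]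
    simp
  have haφ : a φ φ = ∑ i, lam i * c i ^ 2 := by
    rw [hφdef, bilin_sum_sum_of_kronecker a u lam ha_on c]
  have hbpos : 0 < b φ φ := by
    rw [hbφ]
    obtain ⟨i, hi⟩ : ∃ i, c i ≠ 0 := by
      simpa using Function.ne_iff.mp hc0
    have hle : c i ^ 2 ≤ ∑ j, c j ^ 2 :=
      Finset.single_le_sum (f := fun j => c j ^ 2) (fun j _ => sq_nonneg (c j)) (Finset.mem_univ i)
    have : 0 < c i ^ 2 := by positivity
    linarith
  have haΛ : a φ φ ≤ Λ * b φ φ := by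
    rw [haφ, hbφ, Finset.mul_sum]
    exact Finset.sum_le_sum fun i _ => mul_le_mul_of_nonneg_right (hlam i) (sq_nonneg _)
  -- one-vector core for the comparison pair
  have hcore := liu_one_vector a' b' ha'_symm hb'_symm ha'_nonneg hb'_nonneg hC hs proj φ
    (horth φ hφmem) (happrox φ hφmem) (hcoer φ hφmem hℓ)
  have h1C : 0 ≤ 1 + C ^ 2 * s := by positivity
  have : s * b φ φ ≤ (Λ * (1 + C ^ 2 * s)) * b φ φ := by
    calc s * b φ φ ≤ s * b' φ φ := mul_le_mul_of_nonneg_left (hb_le φ) hs.le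
      _ ≤ (1 + C ^ 2 * s) * a' φ φ := hcore
      _ ≤ (1 + C ^ 2 * s) * a φ φ := mul_le_mul_of_nonneg_left (ha'_le φ) h1C
      _ ≤ (1 + C ^ 2 * s) * (Λ * b φ φ) := mul_le_mul_of_nonneg_left haΛ h1C
      _ = (Λ * (1 + C ^ 2 * s)) * b φ φ := by ring
  exact le_of_mul_le_mul_right this hbpos

/-- **One-vector core without positivity of `a`.** In `liu_one_vector` the hypothesis `0 ≤ a x x` is only used at `Πφ` and `φ − Πφ`, where it
follows from the discrete coercivity (`s > 0`, `b ⪰ 0`) resp. from the approximation hypothesis (`C > 0`). Hence Liu's inequality holds for an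
INDEFINITE stiffness form `a` (e.g. `−Δ + V` with a sign-changing potential, no shift) as soon as the certified level `s` is positive; the Liu
correction `C² s` is then quadratic in the LEVEL `s`, not in the shifted eigenvalue. [cite: Liu2015, Thm 2.1] [cite: Liu2026, Thm 2.2] -/
theorem liu_one_vector_indef (a b : LinearMap.BilinForm ℝ V)
    (ha_symm : ∀ x y, a x y = a y x) (hb_symm : ∀ x y, b x y = b y x)
    (hb_nonneg : ∀ x, 0 ≤ b x x)
    {C s : ℝ} (hC : 0 < C) (hs : 0 < s) (proj : V →ₗ[ℝ] V) (φ : V)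
    (horth : a (proj φ) (φ - proj φ) = 0)
    (happrox : b (φ - proj φ) (φ - proj φ) ≤ C ^ 2 * a (φ - proj φ) (φ - proj φ))
    (hcoer : s * b (proj φ) (proj φ) ≤ a (proj φ) (proj φ)) :
    s * b φ φ ≤ (1 + C ^ 2 * s) * a φ φ := by
  set P := proj φ with hP
  set Q := φ - proj φ with hQ
  have hφ : φ = P + Q := by rw [hP, hQ]; abel
  have hbPP := hb_nonneg P
  have hbQQ := hb_nonneg Q
  have haPP : 0 ≤ a P P := le_trans (mul_nonneg hs.le hbPP) hcoer
  have haQQ : 0 ≤ a Q Q := by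
    have hC2 : 0 < C ^ 2 := by positivity
    have h : 0 ≤ C ^ 2 * a Q Q := le_trans hbQQ happrox
    exact (mul_nonneg_iff_of_pos_left hC2).mp h
  have ha_split : a φ φ = a P P + a Q Q := by
    rw [hφ, bilin_add_self a ha_symm P Q, horth]; ring
  have hb_split : b φ φ = b P P + 2 * b P Q + b Q Q := by
    rw [hφ, bilin_add_self b hb_symm P Q]
  set t := C ^ 2 * s with ht
  have htpos : 0 < t := by rw [ht]; positivity
  have hyoung : 2 * t * b P Q ≤ t ^ 2 * b P P + b Q Q := by
    have h := hb_nonneg (t • P - Q)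
    rw [bilin_smul_sub_self b hb_symm t P Q] at h
    linarith
  have key : t * (s * b φ φ) ≤ t * ((1 + C ^ 2 * s) * a φ φ) := by
    rw [hb_split, ha_split]
    have h1 : t * s * (2 * b P Q) ≤ s * (t ^ 2 * b P P + b Q Q) := by nlinarith
    have h2 : s * b Q Q ≤ s * (C ^ 2 * a Q Q) := mul_le_mul_of_nonneg_left happrox hs.le
    have h3 : s * C ^ 2 = t := by rw [ht]; ring
    nlinarith [mul_nonneg htpos.le haPP, mul_nonneg htpos.le haQQ, mul_nonneg htpos.le hbPP,
      mul_nonneg hs.le hbQQ, hcoer, sq_nonneg C]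
  exact le_of_mul_le_mul_left key htpos

/-- **Liu's counting bound, span form** (no eigenfamily needed). If a `k`-dimensional trial family `U` in the exact space has Rayleigh
quotient `a ≤ Λ b` and `b > 0` on its non-zero members, `k > m`, and the discrete side is coercive at level `s` on the common kernel of `m` functionals
(certified inertia), then `s ≤ Λ (1 + C² s)`. The eigenfamily version `liu_count_bound_indef` and the bracketing version `liu_count_bound_bracket`
are corollaries. [cite: Liu2015, Thm 2.1] [folklore] -/
theorem liu_count_bound_span (a b a' b' : LinearMap.BilinForm ℝ V)
    (ha'_symm : ∀ x y, a' x y = a' y x) (hb'_symm : ∀ x y, b' x y = b' y x)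
    (hb'_nonneg : ∀ x, 0 ≤ b' x x)
    {k m : ℕ} (hmk : m < k) (U : (Fin k → ℝ) →ₗ[ℝ] V) {Λ C s : ℝ}
    (hray : ∀ y, a (U y) (U y) ≤ Λ * b (U y) (U y))
    (hbpos : ∀ y, y ≠ 0 → 0 < b (U y) (U y))
    (ha'_le : ∀ y, a' (U y) (U y) ≤ a (U y) (U y))
    (hb_le : ∀ y, b (U y) (U y) ≤ b' (U y) (U y))
    (hC : 0 < C) (hs : 0 < s)
    (proj : V →ₗ[ℝ] V) (ℓ : Fin m → V →ₗ[ℝ] ℝ)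
    (horth : ∀ y, a' (proj (U y)) (U y - proj (U y)) = 0)
    (happrox : ∀ y, b' (U y - proj (U y)) (U y - proj (U y)) ≤ C ^ 2 * a' (U y - proj (U y)) (U y - proj (U y)))
    (hcoer : ∀ y, (∀ j, ℓ j (proj (U y)) = 0) → s * b' (proj (U y)) (proj (U y)) ≤ a' (proj (U y)) (proj (U y))) :
    s ≤ Λ * (1 + C ^ 2 * s) := by
  classical
  let T : (Fin k → ℝ) →ₗ[ℝ] (Fin m → ℝ) := LinearMap.pi fun j => (ℓ j) ∘ₗ proj ∘ₗ U
  have hlt : Module.finrank ℝ (Fin m → ℝ) < Module.finrank ℝ (Fin k → ℝ) := by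
    simpa [Module.finrank_fin_fun] using hmk
  obtain ⟨c, hcker, hc0⟩ :=
    Submodule.exists_mem_ne_zero_of_ne_bot (LinearMap.ker_ne_bot_of_finrank_lt hlt (f := T))
  have hℓ : ∀ j, ℓ j (proj (U c)) = 0 := by
    intro j
    have h := congr_fun (LinearMap.mem_ker.mp hcker) j
    simpa [T, LinearMap.pi_apply] using h
  have hbposc := hbpos c hc0
  have hcore := liu_one_vector_indef a' b' ha'_symm hb'_symm hb'_nonneg hC hs proj (U c)
    (horth c) (happrox c) (hcoer c hℓ)
  have h1C : 0 ≤ 1 + C ^ 2 * s := by positivity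
  have : s * b (U c) (U c) ≤ (Λ * (1 + C ^ 2 * s)) * b (U c) (U c) := by
    calc s * b (U c) (U c) ≤ s * b' (U c) (U c) := mul_le_mul_of_nonneg_left (hb_le c) hs.le
      _ ≤ (1 + C ^ 2 * s) * a' (U c) (U c) := hcore
      _ ≤ (1 + C ^ 2 * s) * a (U c) (U c) := mul_le_mul_of_nonneg_left (ha'_le c) h1C
      _ ≤ (1 + C ^ 2 * s) * (Λ * b (U c) (U c)) := mul_le_mul_of_nonneg_left (hray c) h1C
      _ = (Λ * (1 + C ^ 2 * s)) * b (U c) (U c) := by ring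
  exact le_of_mul_le_mul_right this hbposc

/-- **Liu's counting bound, indefinite comparison form, hypotheses only on the eigen-span.** As `liu_count_bound_of_le`, but (i) no positivity of
`a'` is assumed (see `liu_one_vector_indef`), and (ii) the comparison `a' ≤ a`, `b ≤ b'` is required only on the span of the exact eigenfamily (so
minorants obtained by GLOBAL integration by parts on `H¹`, invalid on broken spaces, are admissible). Use: certify the UNSHIFTED problem at a small
positive level `s = ρ` (Liu correction `C² ρ²`, negligible), with an indefinite potential. [cite: Liu2015, Thm 2.1] [cite: Liu2026, Thm 2.2] -/
theorem liu_count_bound_indef (a b a' b' : LinearMap.BilinForm ℝ V)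
    (ha'_symm : ∀ x y, a' x y = a' y x) (hb'_symm : ∀ x y, b' x y = b' y x)
    (hb'_nonneg : ∀ x, 0 ≤ b' x x)
    {k m : ℕ} (hmk : m < k) (u : Fin k → V) (lam : Fin k → ℝ) {Λ C s : ℝ}
    (ha'_le : ∀ φ ∈ Submodule.span ℝ (Set.range u), a' φ φ ≤ a φ φ)
    (hb_le : ∀ φ ∈ Submodule.span ℝ (Set.range u), b φ φ ≤ b' φ φ)
    (hb_on : ∀ i j, b (u i) (u j) = if i = j then 1 else 0)
    (ha_on : ∀ i j, a (u i) (u j) = if i = j then lam i else 0)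
    (hlam : ∀ i, lam i ≤ Λ) (hC : 0 < C) (hs : 0 < s)
    (proj : V →ₗ[ℝ] V) (ℓ : Fin m → V →ₗ[ℝ] ℝ)
    (horth : ∀ φ ∈ Submodule.span ℝ (Set.range u), a' (proj φ) (φ - proj φ) = 0)
    (happrox : ∀ φ ∈ Submodule.span ℝ (Set.range u),
      b' (φ - proj φ) (φ - proj φ) ≤ C ^ 2 * a' (φ - proj φ) (φ - proj φ))
    (hcoer : ∀ φ ∈ Submodule.span ℝ (Set.range u), (∀ j, ℓ j (proj φ) = 0) →
      s * b' (proj φ) (proj φ) ≤ a' (proj φ) (proj φ)) :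
    s ≤ Λ * (1 + C ^ 2 * s) := by
  classical
  let U : (Fin k → ℝ) →ₗ[ℝ] V := Fintype.linearCombination ℝ u
  have hUapply : ∀ y, U y = ∑ i, y i • u i := fun y => by
    simp [U, Fintype.linearCombination_apply]
  have hmem : ∀ y, U y ∈ Submodule.span ℝ (Set.range u) := fun y => by
    rw [hUapply]
    exact Submodule.sum_mem _ fun i _ => Submodule.smul_mem _ _ (Submodule.subset_span ⟨i, rfl⟩)
  have hbU : ∀ y, b (U y) (U y) = ∑ i, y i ^ 2 := fun y => by
    rw [hUapply, bilin_sum_sum_of_kronecker b u (fun _ => (1 : ℝ)) (by simpa using hb_on) y]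
    simp
  have haU : ∀ y, a (U y) (U y) = ∑ i, lam i * y i ^ 2 := fun y => by
    rw [hUapply, bilin_sum_sum_of_kronecker a u lam ha_on y]
  refine liu_count_bound_span a b a' b' ha'_symm hb'_symm hb'_nonneg hmk U ?_ ?_
    (fun y => ha'_le _ (hmem y)) (fun y => hb_le _ (hmem y)) hC hs proj ℓ
    (fun y => horth _ (hmem y)) (fun y => happrox _ (hmem y)) (fun y => hcoer _ (hmem y))
  · intro y
    rw [haU, hbU, Finset.mul_sum]
    exact Finset.sum_le_sum fun i _ => mul_le_mul_of_nonneg_right (hlam i) (sq_nonneg _)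
  · intro y hy
    rw [hbU]
    obtain ⟨i, hi⟩ : ∃ i, y i ≠ 0 := by
      simpa using Function.ne_iff.mp hy
    have hle : y i ^ 2 ≤ ∑ j, y j ^ 2 :=
      Finset.single_le_sum (f := fun j => y j ^ 2) (fun j _ => sq_nonneg (y j)) (Finset.mem_univ i)
    have : 0 < y i ^ 2 := by positivity
    linarith

/-- **Liu's counting bound with the domain truncation built in** (no min–max, no spectral theorem for the truncated problem). `A, B` are the
full-space forms, `a, b` the exact forms of the truncated region, `Rst` the restriction; the exterior is coercive at level `ρ'`:
`A(φ,φ) ≥ a(φ|,φ|) + ρ'(B(φ,φ) − b(φ|,φ|))`, and `b(φ|,φ|) ≤ B(φ,φ)`, `b ≥ 0`, `a ≥ 0` on `b`-null vectors. If the full problem had `k > m`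
`B`-orthonormal, `A`-diagonal vectors with levels `λ_i ≤ Λ < ρ'` while the truncated discrete problem is coercive at level `s` past `m` functionals
(certified inertia) with Liu's projection data on the restricted span, then `s ≤ Λ(1 + C² s)`. Contrapositive: fewer than `k` full eigenvalues lie
below `min(ρ', s/(1 + C² s))`. [cite: Liu2015, Thm 2.1] [folklore] -/
theorem liu_count_bound_bracket {D : Type*} [AddCommGroup D] [Module ℝ D]
    (A B : LinearMap.BilinForm ℝ D) (a b a' b' : LinearMap.BilinForm ℝ V) (Rst : D →ₗ[ℝ] V)
    (ha'_symm : ∀ x y, a' x y = a' y x) (hb'_symm : ∀ x y, b' x y = b' y x)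
    (hb'_nonneg : ∀ x, 0 ≤ b' x x)
    (hb_nonneg : ∀ v, 0 ≤ b v v) (ha_null : ∀ v, b v v = 0 → 0 ≤ a v v)
    {ρ' : ℝ} (hAa : ∀ φ, a (Rst φ) (Rst φ) + ρ' * (B φ φ - b (Rst φ) (Rst φ)) ≤ A φ φ)
    (hbB : ∀ φ, b (Rst φ) (Rst φ) ≤ B φ φ)
    {k m : ℕ} (hmk : m < k) (Φ : Fin k → D) (lam : Fin k → ℝ) {Λ C s : ℝ}
    (hB_on : ∀ i j, B (Φ i) (Φ j) = if i = j then 1 else 0)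
    (hA_on : ∀ i j, A (Φ i) (Φ j) = if i = j then lam i else 0)
    (hlam : ∀ i, lam i ≤ Λ) (hΛ : Λ < ρ')
    (U : (Fin k → ℝ) →ₗ[ℝ] V) (hU : ∀ y, U y = Rst (∑ i, y i • Φ i))
    (ha'_le : ∀ y, a' (U y) (U y) ≤ a (U y) (U y))
    (hb_le : ∀ y, b (U y) (U y) ≤ b' (U y) (U y))
    (hC : 0 < C) (hs : 0 < s)
    (proj : V →ₗ[ℝ] V) (ℓ : Fin m → V →ₗ[ℝ] ℝ)
    (horth : ∀ y, a' (proj (U y)) (U y - proj (U y)) = 0)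
    (happrox : ∀ y, b' (U y - proj (U y)) (U y - proj (U y)) ≤ C ^ 2 * a' (U y - proj (U y)) (U y - proj (U y)))
    (hcoer : ∀ y, (∀ j, ℓ j (proj (U y)) = 0) → s * b' (proj (U y)) (proj (U y)) ≤ a' (proj (U y)) (proj (U y))) :
    s ≤ Λ * (1 + C ^ 2 * s) := by
  classical
  have hBψ : ∀ y : Fin k → ℝ, B (∑ i, y i • Φ i) (∑ i, y i • Φ i) = ∑ i, y i ^ 2 := fun y => by
    rw [bilin_sum_sum_of_kronecker B Φ (fun _ => (1 : ℝ)) (by simpa using hB_on) y]; simp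
  have hAψ : ∀ y : Fin k → ℝ, A (∑ i, y i • Φ i) (∑ i, y i • Φ i) = ∑ i, lam i * y i ^ 2 := fun y => by
    rw [bilin_sum_sum_of_kronecker A Φ lam hA_on y]
  have hAΛ : ∀ y : Fin k → ℝ, A (∑ i, y i • Φ i) (∑ i, y i • Φ i) ≤ Λ * B (∑ i, y i • Φ i) (∑ i, y i • Φ i) := fun y => by
    rw [hAψ, hBψ, Finset.mul_sum]
    exact Finset.sum_le_sum fun i _ => mul_le_mul_of_nonneg_right (hlam i) (sq_nonneg _)
  have hBpos : ∀ y : Fin k → ℝ, y ≠ 0 → 0 < B (∑ i, y i • Φ i) (∑ i, y i • Φ i) := fun y hy => by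
    rw [hBψ]
    obtain ⟨i, hi⟩ : ∃ i, y i ≠ 0 := by
      simpa using Function.ne_iff.mp hy
    have hle : y i ^ 2 ≤ ∑ j, y j ^ 2 :=
      Finset.single_le_sum (f := fun j => y j ^ 2) (fun j _ => sq_nonneg (y j)) (Finset.mem_univ i)
    have : 0 < y i ^ 2 := by positivity
    linarith
  refine liu_count_bound_span a b a' b' ha'_symm hb'_symm hb'_nonneg hmk U ?_ ?_ ha'_le hb_le hC hs proj ℓ
    horth happrox hcoer
  · intro y
    have h1 := hAa (∑ i, y i • Φ i)
    have h2 := hAΛ y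
    have h3 := mul_le_mul_of_nonpos_left (hbB (∑ i, y i • Φ i)) (sub_nonpos.mpr hΛ.le)
    rw [hU]
    nlinarith [h1, h2, h3]
  · intro y hy
    rw [hU]
    by_contra hneg
    have hb0 : b (Rst (∑ i, y i • Φ i)) (Rst (∑ i, y i • Φ i)) = 0 :=
      le_antisymm (not_lt.mp hneg) (hb_nonneg _)
    have ha0 := ha_null _ hb0
    have h1 := hAa (∑ i, y i • Φ i)
    have h2 := hAΛ y
    have h4 := hBpos y hy
    rw [hb0, sub_zero] at h1
    have h5 := mul_lt_mul_of_pos_right hΛ h4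
    linarith

/-- **Stage-R output as a cardinality bound.** In the setting of `liu_count_bound_bracket`: if the truncated discrete problem is certified
coercive at level `s` past `N` pin functionals, `ρ_R (1 + C² s) ≤ s` and `ρ_R ≤ ρ'` (exterior level), then the full problem has AT MOST `N`
`B`-orthonormal `A`-diagonal vectors with levels `< ρ_R` — the `m ≤ n + k` input of the two-stage count. [cite: Liu2015, Thm 2.1] [folklore] -/
theorem liu_card_le_bracket {D : Type*} [AddCommGroup D] [Module ℝ D]
    (A B : LinearMap.BilinForm ℝ D) (a b a' b' : LinearMap.BilinForm ℝ V) (Rst : D →ₗ[ℝ] V)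
    (ha'_symm : ∀ x y, a' x y = a' y x) (hb'_symm : ∀ x y, b' x y = b' y x)
    (hb'_nonneg : ∀ x, 0 ≤ b' x x)
    (hb_nonneg : ∀ v, 0 ≤ b v v) (ha_null : ∀ v, b v v = 0 → 0 ≤ a v v)
    {ρ' ρR : ℝ} (hAa : ∀ φ, a (Rst φ) (Rst φ) + ρ' * (B φ φ - b (Rst φ) (Rst φ)) ≤ A φ φ)
    (hbB : ∀ φ, b (Rst φ) (Rst φ) ≤ B φ φ)
    {m N : ℕ} (Φ : Fin m → D) (lam : Fin m → ℝ) {C s : ℝ}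
    (hB_on : ∀ i j, B (Φ i) (Φ j) = if i = j then 1 else 0)
    (hA_on : ∀ i j, A (Φ i) (Φ j) = if i = j then lam i else 0)
    (hlam_lt : ∀ i, lam i < ρR) (hρR : ρR ≤ ρ') (hC : 0 < C) (hs : 0 < s) (hρRs : ρR * (1 + C ^ 2 * s) ≤ s)
    (U : (Fin m → ℝ) →ₗ[ℝ] V) (hU : ∀ y, U y = Rst (∑ i, y i • Φ i))
    (ha'_le : ∀ y, a' (U y) (U y) ≤ a (U y) (U y))
    (hb_le : ∀ y, b (U y) (U y) ≤ b' (U y) (U y))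
    (proj : V →ₗ[ℝ] V) (ℓ : Fin N → V →ₗ[ℝ] ℝ)
    (horth : ∀ y, a' (proj (U y)) (U y - proj (U y)) = 0)
    (happrox : ∀ y, b' (U y - proj (U y)) (U y - proj (U y)) ≤ C ^ 2 * a' (U y - proj (U y)) (U y - proj (U y)))
    (hcoer : ∀ y, (∀ j, ℓ j (proj (U y)) = 0) → s * b' (proj (U y)) (proj (U y)) ≤ a' (proj (U y)) (proj (U y))) :
    m ≤ N := by
  classical
  by_contra hlt
  push Not at hlt
  -- m ≥ 1, so the finite family of levels has a maximum Λ < ρ_R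
  have hm : 0 < m := by omega
  haveI : Nonempty (Fin m) := ⟨⟨0, hm⟩⟩
  obtain ⟨i₀, -, hi₀⟩ := Finset.exists_max_image Finset.univ lam Finset.univ_nonempty
  set Λ := lam i₀ with hΛdef
  have hlamΛ : ∀ i, lam i ≤ Λ := fun i => hi₀ i (Finset.mem_univ i)
  have hΛρ : Λ < ρ' := lt_of_lt_of_le (hlam_lt i₀) hρR
  have hmain := liu_count_bound_bracket A B a b a' b' Rst ha'_symm hb'_symm hb'_nonneg hb_nonneg ha_null hAa hbB
    hlt Φ lam hB_on hA_on hlamΛ hΛρ U hU ha'_le hb_le hC hs proj ℓ horth happrox hcoer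
  have h1C : 0 < 1 + C ^ 2 * s := by positivity
  have : Λ * (1 + C ^ 2 * s) < ρR * (1 + C ^ 2 * s) := mul_lt_mul_of_pos_right (hlam_lt i₀) h1C
  linarith

section MatrixGlue
open Matrix

/-- A bilinear form on a finite combination is the matrix quadratic form of its Gram matrix. [folklore] -/
private theorem plb_bilin_combo (f : LinearMap.BilinForm ℝ V) (hsymm : ∀ x y, f x y = f y x) {n : ℕ} (ψ : Fin n → V)
    (G : Matrix (Fin n) (Fin n) ℝ) (hG : ∀ i j, G i j = f (ψ i) (ψ j)) (y : Fin n → ℝ) :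
    f (∑ i, y i • ψ i) (∑ j, y j • ψ j) = y ⬝ᵥ (G *ᵥ y) := by
  simp only [map_sum, map_smul, LinearMap.sum_apply, LinearMap.smul_apply, smul_eq_mul, dotProduct,
    Matrix.mulVec, hG]
  simp only [Finset.mul_sum]
  refine Finset.sum_congr rfl fun i _ => Finset.sum_congr rfl fun j _ => ?_
  rw [hsymm (ψ j) (ψ i)]
  ring

/-- **From the certified inertia to the discrete coercivity `hcoer`.** Let `K, M` be the stiffness and mass Gram matrices of the discrete forms
`a', b'` on the basis `ψ_1..ψ_n` of the nonconforming space. If `yᵀ(K − sM)y ≥ 0` for every coefficient vector `y` annihilated by the pin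
functionals `q_j` (what `fromBlocks_dotProduct_nonneg_of_schur[_posDef]` + `dotProduct_mulVec_nonneg_of_posSemidef_add` certify from a block
`LDLᵀ` / deflation), then `s·b'(v,v) ≤ a'(v,v)` for every `v = Σ y_i ψ_i` with `q_j·y = 0` — hypothesis `hcoer` of `liu_count_bound_span` /
`liu_count_bound_indef` / `liu_count_bound_bracket` (with `ℓ_j(proj φ) = q_j · coeff(proj φ)`). [folklore] -/
theorem hcoer_of_matrices (a' b' : LinearMap.BilinForm ℝ V)
    (ha'_symm : ∀ x y, a' x y = a' y x) (hb'_symm : ∀ x y, b' x y = b' y x)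
    {n p : ℕ} (ψ : Fin n → V) (K M : Matrix (Fin n) (Fin n) ℝ)
    (hK : ∀ i j, K i j = a' (ψ i) (ψ j)) (hM : ∀ i j, M i j = b' (ψ i) (ψ j))
    {s : ℝ} (q : Fin p → Fin n → ℝ)
    (hpos : ∀ y : Fin n → ℝ, (∀ j, q j ⬝ᵥ y = 0) → 0 ≤ y ⬝ᵥ ((K - s • M) *ᵥ y))
    (y : Fin n → ℝ) (hq : ∀ j, q j ⬝ᵥ y = 0) :
    s * b' (∑ i, y i • ψ i) (∑ i, y i • ψ i) ≤ a' (∑ i, y i • ψ i) (∑ i, y i • ψ i) := by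
  have h := hpos y hq
  rw [Matrix.sub_mulVec, Matrix.smul_mulVec, dotProduct_sub, dotProduct_smul, smul_eq_mul,
    ← plb_bilin_combo a' ha'_symm ψ K hK y, ← plb_bilin_combo b' hb'_symm ψ M hM y] at h
  linarith

end MatrixGlue

end Literature.Analysis.OperatorTheory
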